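import Summits.HodgeConjecture.HodgeConjecture.Theses.EightfoldTwistedSheafSeeds
import HarnessLib
import HarnessLib.Audit

/-!
# Birth skeleton (BC3) of the crux `SheafSeedGaussSq` — route `EightfoldTwistedSheafSeeds` (sibling of №3 EightfoldBlochSeeds, rung H2)

THE LINE (Markman's secant-sheaf door at n = 4, K = ℚ(i)): the crux asks, for SOME m ≥ 1, one ADMISSIBLE (gluable-σ-semiregular ∨
Buchweitz–Flenner single-sheaf I-semiregular) B-twisted perfect object on a hyperbolic ℚ(i)-Weil abelian eightfold (ψ₀² = −m²) whose
κ₄ has a NON-ZERO rational Weil component.  Intended witness: Markman's genus-4 secant sheaf F = I_Z(Θ) on X = Pic³(C)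
(Z = ∪ translates of W_k, a₃ = 1, a₂ = 2, a₁ = 0, a₀ = 4; [Markman2025SecantWeil, Ex. 8.2.3]) modified to F' (partial normalisation)
and descended to the ℚ(i)-Weil eightfold (X × X̂)/G ([Markman2025SurveySecant, §11, Q. 11.4, Prop. 11.5]); memo SHEAF-DOOR-SPEC §4:
|G| = 2 ⇒ m = 2.  The skeleton PINS m = 2 (discriminant 4 = 2²).

* STUB R `stub_twistedSeedGaussFour` — THE BET (= BC5 plan-only rung): the crux at the pinned parameter m = 2.  Technique: Markman's
  construction + his Question 8.2.4 at n = 4 (injectivity of the G₁-invariant semiregularity map on Ext²(F',F'); affirmative at n = 3,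
  [Markman2025SecantWeil, Ex. 8.2.3–8.2.5]) for the σ-disjunct, or Buchweitz–Flenner I-semiregularity of the descended reflexive sheaf
  for the BF' disjunct.  Why it might fail: F_d itself is NOT semiregular (dim Ext²(F_d,F_d) = 8d(d+1) − 2 + 2·dim Ext¹); Q. 11.4 of the
  survey: the descended sheaf cannot be semiregular for all q ≥ 4.
* STUB C `stub_twistedClassCarrierGaussFour` — SUB-RUNG, strictly WEAKER than R (`classCarrier_of_seed`): the CLASS HALF — the same
  existential with the admissibility predicate DELETED (every bounded complex admissible): a B-twisted perfect object with κ₄ = q·h_K⁴ + w,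
  w ≠ 0 rational in the ℚ(i)-Weil plane of a hyperbolic eightfold with ψ₀² = −4.  In print for the UNdescended secant sheaf at every n
  ([Markman2025SecantWeil, Ex. 8.2.3]: ch(F) = α + a_{n−1}β, β the imaginary part of exp(√−d Θ)); the descent is implemented for dim ≤ 6 only
  ([Markman2025SurveySecant, p. 4]) — so OPEN as typed, routine-expected; NOT a T3 witness (no semiregularity clause).
* `SheafSeedGaussSq_of` — the kernel-checked composition: STUB R ⟹ the crux (m := 2), no sorry.

Honours the cell's negative knowledge: the torus-carrier no-gos of Cruxes/BlochSeedDiscOne (ε-syzygy `not_gluableSigmaAdmissible_of_epsTraceInputs`,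
TorusCarrierTraceNoGo) quantify over split / point-glued complexes of structure sheaves of product sub-tori of E₀⁸; the intended witness is a
descended secant sheaf on a Jacobian-type carrier, not of that shape.  No landed Negative lemma concerns twisted objects at level 4.
-/

noncomputable section

namespace Summit.HodgeConjecture.HodgeConjecture.Cruxes.SheafSeedGaussSq.Birth

open Literature.AlgebraicGeometry.HodgeTheory Summit.Ventures.HSemireg

/-- The route's admissibility notion: gluable-σ-semiregular OR Buchweitz–Flenner single-sheaf I-semiregular (verbatim the crux's lambda). -/
abbrev AdmTw : PerfectAdmissibility := fun n X₀ I E => gluableSigmaAdmissible n X₀ I E ∨ bfSingleAdmissible' n X₀ I E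

/-- The trivial admissibility notion (every bounded complex admissible): the CLASS-HALF vocabulary of STUB C. -/
abbrev AdmAll : PerfectAdmissibility := fun _ _ _ _ => True

/-! ## Registered stubs -/

/-- **STUB R — THE BET / BC5 plan-only rung (m = 2 pinned)**: for every Chern-character datum `C`, a hyperbolic seed of the twisted
admissible class at level 4, discriminant 4 = 2² (Markman's genus-4 descended secant sheaf is the intended witness; his Q. 8.2.4 at n = 4
is the open point). [cite: Markman2025SecantWeil, Ex. 8.2.3 and Q. 8.2.4] [cite: BuchweitzFlenner2003, §5] [cite: Pridham2024Semiregularity, Cor. 2.25] -/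
theorem stub_twistedSeedGaussFour :
    ∀ C : ChernCharacterBetti, HasHyperbolicSeedOn (twistedReflexiveClass C AdmTw) 4 4 := by
  sorry

/-- **STUB C — SUB-RUNG (class half; admissibility deleted; strictly weaker than STUB R by `classCarrier_of_seed`)**: a B-twisted perfect
object with κ₄ = q·h_K⁴ + w, w ≠ 0 rational in the ℚ(i)-Weil plane, on a hyperbolic Weil eightfold with ψ₀² = −4.
[cite: Markman2025SecantWeil, Ex. 8.2.3 (ch(F) = α + a_{n-1}β)] [cite: Markman2025SurveySecant, §11] -/
theorem stub_twistedClassCarrierGaussFour :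
    ∀ C : ChernCharacterBetti, HasHyperbolicSeedOn (twistedReflexiveClass C AdmAll) 4 4 := by
  sorry

/-! ## The ladder and the composition (no sorry below) -/

/-- STUB R ⟹ STUB C statementwise (so STUB C is ON PATH): widen the admissibility notion
(`twistedReflexiveClass.mono`, `HasHyperbolicSeedOn.mono`). [folklore] -/
theorem classCarrier_of_seed (h : ∀ C : ChernCharacterBetti, HasHyperbolicSeedOn (twistedReflexiveClass C AdmTw) 4 4) :
    ∀ C : ChernCharacterBetti, HasHyperbolicSeedOn (twistedReflexiveClass C AdmAll) 4 4 :=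
  fun C => (h C).mono fun _ _ _ _ hκ => twistedReflexiveClass.mono (fun _ _ _ _ _ => trivial) hκ

/-- **The composition — STUB R ⟹ the crux BY NAME** (m := 2; `2 ^ 2 = 4`); hypothesis-free, the registered stub is used by name
(this is the theorem `ledger skeleton check` registers). -/
theorem SheafSeedGaussSq_of : Summit.HodgeConjecture.HodgeConjecture.Theses.EightfoldTwistedSheafSeeds.SheafSeedGaussSq :=
  ⟨2, two_pos, fun C => by simpa using stub_twistedSeedGaussFour C⟩

end Summit.HodgeConjecture.HodgeConjecture.Cruxes.SheafSeedGaussSq.Birth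

end
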